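import Summits.Parity.GeneralizedHardyLittlewood.Theorems.BeyondDiagonalBeatsQuarter.OffDiagBoxesNearFar
import Mathlib.NumberTheory.Harmonic.Bounds
import HarnessLib

/-!
# Route `PrimeLevelFamEdge`, crux K_B (stmt-Parity-20343), line `diagonal_kernel_split` rev 4, plan Ω,
# worker key L3 (part 6d, tools) `OffDiagDualLedgerTools`: two arithmetic sums of the trivial ledger —
# `Σ_{r ≤ R} gcd(a,r)/r ≤ τ(a)(1 + log R)` and the number of NEAR dyadic boxes `≤ (log₂⌊4q̂²y₀⌋ + 1)²`

The per-box row of L3 (`OffDiagDualBoxLedgerScaled.sum_dualBox_norm_le_of_truncation`) carries the factor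
`gcd(α, qr)·r⁻¹` and is summed over the layers `r ≤ q⁷` and the near boxes `i ∈ nearBoxes q d₁ d₂ y₀`
(`2^{i₁+i₂}d₁d₂ < 4q̂²y₀`). This file supplies the two counting tools:
* **`sum_gcd_div_le`** — for `a ≥ 1` (any `R`): `Σ_{r=1}^{R} gcd(a,r)/r ≤ τ(a)·(1 + log R)`
  (`gcd(a,r) ≤ Σ_{e∣a, e∣r} e`, then `r = er′` and the harmonic bound `H_R ≤ 1 + log R`);
  at prime level `gcd(α, qr) = gcd(α, r)` for `α < q` (`gcd_mul_primeLevel`);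
* **`card_nearBoxes_le`** — `#nearBoxes q d₁ d₂ y₀ ≤ (Nat.log 2 ⌊4q̂²y₀⌋₊ + 1)²` (a near box has
  `2^{i_j} ≤ 2^{i₁+i₂} < 4q̂²y₀`).
Elementary; nothing about the heart. Helper (`--supports stmt-Parity-20343`); standard axioms.
«The programme SEARCHES and TYPES; no claim about Landau–Siegel zeros, Theorems 1–2 of arXiv:2211.02515 or
a repaired Margin232 until a kernel theorem says so.»
-/

noncomputable section

open Finset
open scoped Real

namespace Summit.Parity.GeneralizedHardyLittlewood.Theorems.BeyondDiagonalBeatsQuarter.OffDiag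

open Literature.NumberTheory.LFunctions Literature.NumberTheory.LFunctions.KMV2000

/-! ### §1. The gcd-weighted harmonic sum -/

/-- `gcd(a,r)/r ≤ Σ_{e ∣ a} 𝟙[e ∣ r]·e/r` (the gcd is one of the terms; `a ≥ 1`). [folklore] -/
theorem gcd_div_le_sum_divisors {a : ℕ} (ha : 1 ≤ a) (r : ℕ) :
    ((Nat.gcd a r : ℕ) : ℝ) / r ≤ ∑ e ∈ a.divisors, (if e ∣ r then (e : ℝ) / r else 0) := by
  have hmem : Nat.gcd a r ∈ a.divisors := Nat.mem_divisors.2 ⟨Nat.gcd_dvd_left a r, by omega⟩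
  have hnn : ∀ e ∈ a.divisors, 0 ≤ (if e ∣ r then (e : ℝ) / r else 0) := fun e _ ↦ by
    split_ifs <;> positivity
  refine le_trans (le_of_eq ?_) (Finset.single_le_sum hnn hmem)
  rw [if_pos (Nat.gcd_dvd_right a r)]

/-- For `e ≥ 1`: `Σ_{r ≤ R, e ∣ r} e/r ≤ Σ_{r′ ≤ R} 1/r′` (`r = er′`). [folklore] -/
theorem sum_Icc_ite_dvd_div_le {e : ℕ} (he : 1 ≤ e) (R : ℕ) :
    ∑ r ∈ Finset.Icc 1 R, (if e ∣ r then (e : ℝ) / r else 0) ≤ ∑ r' ∈ Finset.Icc 1 R, (1 : ℝ) / r' := by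
  classical
  have he0 : (0 : ℝ) < e := by exact_mod_cast he
  rw [← Finset.sum_filter]
  -- the multiples of `e` in `[1,R]` are the image of `[1, R/e]` under `r' ↦ e r'`
  have hsub : (Finset.Icc 1 R).filter (fun r ↦ e ∣ r) ⊆ (Finset.Icc 1 R).image (fun r' ↦ e * r') := by
    intro r hr
    rw [Finset.mem_filter, Finset.mem_Icc] at hr
    obtain ⟨⟨h1, h2⟩, ⟨k, hk⟩⟩ := hr
    rw [Finset.mem_image]
    refine ⟨k, Finset.mem_Icc.2 ⟨?_, ?_⟩, hk.symm⟩
    · rcases Nat.eq_zero_or_pos k with h0 | h0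
      · rw [h0, mul_zero] at hk; omega
      · exact h0
    · calc k ≤ e * k := Nat.le_mul_of_pos_left k he
        _ = r := hk.symm
        _ ≤ R := h2
  have hnn : ∀ r ∈ (Finset.Icc 1 R).image (fun r' ↦ e * r'), 0 ≤ (e : ℝ) / r := fun _ _ ↦ by positivity
  have hinj : Set.InjOn (fun r' ↦ e * r') ((Finset.Icc 1 R : Finset ℕ) : Set ℕ) :=
    fun x _ y _ h ↦ Nat.eq_of_mul_eq_mul_left he h
  calc ∑ r ∈ (Finset.Icc 1 R).filter (fun r ↦ e ∣ r), (e : ℝ) / r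
      ≤ ∑ r ∈ (Finset.Icc 1 R).image (fun r' ↦ e * r'), (e : ℝ) / r :=
        Finset.sum_le_sum_of_subset_of_nonneg hsub fun r hr _ ↦ hnn r hr
    _ = ∑ r' ∈ Finset.Icc 1 R, (e : ℝ) / ((e * r' : ℕ) : ℝ) := Finset.sum_image hinj
    _ = ∑ r' ∈ Finset.Icc 1 R, (1 : ℝ) / r' := by
        refine Finset.sum_congr rfl fun r' hr' ↦ ?_
        have hr0 : (0 : ℝ) < r' := by exact_mod_cast (Finset.mem_Icc.1 hr').1
        push_cast
        field_simp

/-- **`Σ_{r=1}^{R} gcd(a,r)/r ≤ τ(a)·(1 + log R)`** for `a ≥ 1` (any `R`). [folklore] -/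
theorem sum_gcd_div_le {a : ℕ} (ha : 1 ≤ a) (R : ℕ) :
    ∑ r ∈ Finset.Icc 1 R, ((Nat.gcd a r : ℕ) : ℝ) / r ≤ (a.divisors.card : ℝ) * (1 + Real.log R) := by
  have hH : ∑ r' ∈ Finset.Icc 1 R, (1 : ℝ) / r' ≤ 1 + Real.log R := by
    have h := harmonic_le_one_add_log R
    rw [harmonic_eq_sum_Icc] at h
    push_cast at h
    simpa [one_div] using h
  calc ∑ r ∈ Finset.Icc 1 R, ((Nat.gcd a r : ℕ) : ℝ) / r
      ≤ ∑ r ∈ Finset.Icc 1 R, ∑ e ∈ a.divisors, (if e ∣ r then (e : ℝ) / r else 0) :=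
        Finset.sum_le_sum fun r _ ↦ gcd_div_le_sum_divisors ha r
    _ = ∑ e ∈ a.divisors, ∑ r ∈ Finset.Icc 1 R, (if e ∣ r then (e : ℝ) / r else 0) := Finset.sum_comm
    _ ≤ ∑ e ∈ a.divisors, (1 + Real.log R) :=
        Finset.sum_le_sum fun e he ↦ (sum_Icc_ite_dvd_div_le (Nat.pos_of_mem_divisors he) R).trans hH
    _ = (a.divisors.card : ℝ) * (1 + Real.log R) := by rw [Finset.sum_const, nsmul_eq_mul]

/-- **Prime level**: for `q` prime and `1 ≤ a < q`, `gcd(a, qr) = gcd(a, r)`. [folklore] -/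
theorem gcd_mul_primeLevel {q a : ℕ} (hq : q.Prime) (ha : 1 ≤ a) (haq : a < q) (r : ℕ) :
    Nat.gcd a (q * r) = Nat.gcd a r :=
  Nat.Coprime.gcd_mul_left_cancel_right r
    ((Nat.Prime.coprime_iff_not_dvd hq).mpr (Nat.not_dvd_of_pos_of_lt ha haq))

/-! ### §2. The number of near boxes -/

/-- **`#nearBoxes q d₁ d₂ y₀ ≤ (log₂⌊4q̂²y₀⌋ + 1)²`** for `d₁d₂ ≥ 1`: a near box has
`2^{i_j} ≤ 2^{i₁+i₂} ≤ 2^{i₁+i₂}d₁d₂ < 4q̂²y₀`, so `i_j ≤ log₂⌊4q̂²y₀⌋`. [folklore] -/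
theorem card_nearBoxes_le {q d₁ d₂ : ℕ} (hd : 1 ≤ d₁ * d₂) (y₀ : ℝ) :
    (PeterssonSplit.nearBoxes q d₁ d₂ y₀).card ≤ (Nat.log 2 ⌊4 * qhat q ^ 2 * y₀⌋₊ + 1) ^ 2 := by
  classical
  set m : ℕ := Nat.log 2 ⌊4 * qhat q ^ 2 * y₀⌋₊ + 1 with hm
  have hsub : PeterssonSplit.nearBoxes q d₁ d₂ y₀ ⊆ Finset.range m ×ˢ Finset.range m := by
    intro i hi
    have hfar := PeterssonSplit.not_far_of_mem_nearBoxes hi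
    rw [not_le] at hfar
    have hd' : (1 : ℝ) ≤ (d₁ : ℝ) * d₂ := by exact_mod_cast hd
    have hT : (2 : ℝ) ^ (i.1 + i.2) < 4 * qhat q ^ 2 * y₀ :=
      lt_of_le_of_lt (le_mul_of_one_le_right (by positivity) hd') hfar
    -- `2^{i₁+i₂} ≤ ⌊T⌋` as naturals
    have hfl : 2 ^ (i.1 + i.2) ≤ ⌊4 * qhat q ^ 2 * y₀⌋₊ :=
      Nat.le_floor (by exact_mod_cast hT.le)
    have hne : ⌊4 * qhat q ^ 2 * y₀⌋₊ ≠ 0 := by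
      intro h0; rw [h0] at hfl; exact absurd hfl (not_le.2 (by positivity))
    have hlog : ∀ k : ℕ, 2 ^ k ≤ 2 ^ (i.1 + i.2) → k < m := by
      intro k hk
      rw [hm, Nat.lt_add_one_iff]
      exact (Nat.le_log_iff_pow_le (by norm_num) hne).2 (hk.trans hfl)
    rw [Finset.mem_product, Finset.mem_range, Finset.mem_range]
    exact ⟨hlog i.1 (Nat.pow_le_pow_right (by norm_num) (Nat.le_add_right _ _)),
      hlog i.2 (Nat.pow_le_pow_right (by norm_num) (Nat.le_add_left _ _))⟩
  calc (PeterssonSplit.nearBoxes q d₁ d₂ y₀).card ≤ (Finset.range m ×ˢ Finset.range m).card :=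
        Finset.card_le_card hsub
    _ = m ^ 2 := by rw [Finset.card_product, Finset.card_range, sq]

end Summit.Parity.GeneralizedHardyLittlewood.Theorems.BeyondDiagonalBeatsQuarter.OffDiag
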